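import Literature.AlgebraicGeometry.ModuliOfAbelianVarieties.SiegelAdelicMarkingTransportAlongIso
import Literature.AlgebraicGeometry.AbelianSchemes.IsLambdaOfAtOfIsBaseChangeVia
import Literature.AlgebraicGeometry.AbelianSchemes.PolarizationLevelBaseQuotientDescent
import Literature.AlgebraicGeometry.AbelianSchemes.AbelianSchemeDualTransportLambda
import HarnessLib

/-!
# The (ADM)-package of a pulled-back triple moves between ANY two pull-backs over the same moduli point, marking exposed
# ([MumfordFogartyKirwan1994] Ch. 7 §2 Def. 7.2–7.3; [Milne2005ShimuraVarieties] §6 Thm. 6.11; [Lan2013PELCompactifications] §1.3.6)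

Topic `Literature/AlgebraicGeometry/ModuliOfAbelianVarieties`; namespace `Literature.AlgebraicGeometry.ModuliOfAbelianVarieties`.  THEOREMS ONLY (no definition, no
named fact, no instance, no notation, no `sorry`).  Sequel of ★ RD-T1 `SiegelAdelicMarking.exists_admPackage_of_fibreIso` (p847506).  Cell `hodgecm-mathlib` (D-0151),
FLOOR 0, P6 «MOD» (crux hLiu418 = stmt-HodgeConjecture-24832, `--supports`), organ **RD-T3** of the E6 closer of `Cruxes/HLiu418/Lines/F0_P6a_PELWitnessE.lean` (socket
Σ-AN `ReadsCReading`, census `CENSUS-SigmaAN.v2` row RD; E6 heir A-p06 (g33)): ★ P-3 `siegelUniversalFamilyUniformisation` hands the (ADM)-package of the universal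
family pulled back to a PIECE `X_q` of the complexified record curve at the analytic point `φT t`, while `ReadsCReading` wants it for the pull-back `P` over the
record curve `X` at the complex point `x` — two pull-backs of ONE triple `univ` at points with THE SAME image in the moduli scheme.  HC_CM is proved only
modulo the printed citations (2 remaining named inputs hLiu418 24832, h413 24833) until rung 0 closes; this file is generic and changes no count.

THE MATHEMATICS.  Let `P₁ → Q` along `φ₁ : S₁ → M` and `P₂ → Q` along `φ₂ : S₂ → M` be pull-backs of polarized abelian schemes with level structure
(★ `PolarizedAbelianSchemeWithLevel.IsBaseChangeVia`, [MumfordFogartyKirwan1994] Def. 7.2) and `s₁`, `s₂` complex points with `s₂ ≫ φ₂ = s₁ ≫ φ₁`.  The fibres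
`(P₁)_{s₁}`, `(P₂)_{s₂}` are both the fibre of `Q` at that point: there are isomorphisms `eᵢ : (Pᵢ)_{sᵢ} ≅ Q_{sᵢ ≫ φᵢ}` over `Gᵢ` (★ `IsBaseChangeVia.exists_fibreIso`)
carrying the level sections (§1: `σ′ᵢ ≫ G = φ ≫ σᵢ` read on the fibre) and the ample `λ̄ = Λ(𝒪(Θ))` witnesses in both directions (★ `…IsBaseChangeVia.isLambdaOfAt_of_fibreIso`,
★ `transfer_of_fibreIso`).  Hence (§2) an (ADM)-package `(m, Θ, Λ)` of `P₁` at `s₁` for `(Z, r)` yields one of `P₂` at `s₂` for the same `(Z, r)`, with the same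
lattice frame and complex coordinates and torus map `e₂⁻¹ ∘ e₁ ∘ toFun` (two applications of ★ RD-T1).

* §1 `map_restrictPt_level_eq_of_fibreIso` — a fibre isomorphism over `G` of a pull-back of triples carries level sections to level sections.
* §2 **`SiegelAdelicMarking.exists_admPackage_along_isBaseChangeVia₂`** — THE HEAD.

## References
* [MumfordFogartyKirwan1994] D. Mumford, J. Fogarty, F. Kirwan, *Geometric Invariant Theory*, 3rd ed. (1994), Ch. 7 §2 Definition 7.2 (p. 129), Definition 7.3 (p. 130).
* [Milne2005ShimuraVarieties] J. S. Milne, *Introduction to Shimura Varieties* (2005; rev. 2017), §6 Thm. 6.11 pp. 74–75.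
* [Lan2013PELCompactifications] K.-W. Lan, *Arithmetic compactifications of PEL-type Shimura varieties* (2013), §1.3.6 Lemma 1.3.6.5 (p. 81).
-/

set_option autoImplicit false

noncomputable section

open CategoryTheory CategoryTheory.Limits AlgebraicGeometry Matrix Topology

namespace Literature.AlgebraicGeometry.ModuliOfAbelianVarieties

open Literature.AlgebraicGeometry.Motives (SchemeOver ComplexPoints AlgPoints specOver AbelianVariety CartierDivisor)
open Literature.AlgebraicGeometry.AbelianSchemes (PolarizedAbelianSchemeWithLevel AbelianSchemeOver)
open Literature.Geometry.Kaehler (ComplexTorus)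
open Literature.NumberTheory.Automorphic (siegelUpperHalfSpace)
open SiegelModuli (jOfSiegel)

variable {g N : ℕ} {δ : Fin g → ℕ}

/-! ### §1 Level sections under a fibre isomorphism over `G` -/

/-- **A fibre isomorphism over `G` of a pull-back of triples carries the level sections at `s′` to the level sections at `s′ ≫ f`** (the level clause
`σ′ᵢ ≫ G = f ≫ σᵢ` of ★ `IsBaseChangeVia`, read through ★ `restrictPt_left_fst` and the injectivity of ★ `fibrePointToLeft`).
[cite: MumfordFogartyKirwan1994, Ch. 7 §2 Definition 7.2 (p. 129)] -/
theorem map_restrictPt_level_eq_of_fibreIso {S S' : Scheme.{0}} {P : PolarizedAbelianSchemeWithLevel g N δ S}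
    {P' : PolarizedAbelianSchemeWithLevel g N δ S'} {f : S' ⟶ S} {G : P'.A.X.left ⟶ P.A.X.left} {Ĝ : P'.D.hat.X.left ⟶ P.D.hat.X.left}
    (h : P'.IsBaseChangeVia P f G Ĝ) (s' : Spec (.of ℂ) ⟶ S')
    (e : (P'.A.fibre s').toAbelianVariety ≅ (P.A.fibre (s' ≫ f)).toAbelianVariety)
    (he : AbelianVariety.Hom.toSchemeHom e.hom ≫ pullback.fst P.A.X.hom (s' ≫ f) = pullback.fst P'.A.X.hom s' ≫ G) (i : Fin g ⊕ Fin g) :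
    AlgPoints.map e.hom.hom.hom.hom (P'.A.restrictPt s' (P'.level.σ i)) = P.A.restrictPt (s' ≫ f) (P.level.σ i) := by
  apply P.A.fibrePointToLeft_injective (s' ≫ f)
  -- the point of `P.A` under `e (σ′ᵢ(s′))` is `σ′ᵢ(s′) ≫ G = s′ ≫ σ′ᵢ ≫ G = s′ ≫ f ≫ σᵢ`
  have h1 : P.A.fibrePointToLeft (s' ≫ f) (AlgPoints.map e.hom.hom.hom.hom (P'.A.restrictPt s' (P'.level.σ i))) =
      P'.A.fibrePointToLeft s' (P'.A.restrictPt s' (P'.level.σ i)) ≫ G := by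
    change ((P'.A.restrictPt s' (P'.level.σ i)) ≫ e.hom.hom.hom.hom).left ≫ pullback.fst P.A.X.hom (s' ≫ f) = _
    rw [Over.comp_left, Category.assoc]
    exact (congrArg (fun x => (P'.A.restrictPt s' (P'.level.σ i)).left ≫ x) he).trans (Category.assoc _ _ _).symm
  have h2 : P'.A.fibrePointToLeft s' (P'.A.restrictPt s' (P'.level.σ i)) = s' ≫ (P'.level.σ i).left :=
    P'.A.restrictPt_left_fst s' (P'.level.σ i)
  have h3 : P.A.fibrePointToLeft (s' ≫ f) (P.A.restrictPt (s' ≫ f) (P.level.σ i)) = (s' ≫ f) ≫ (P.level.σ i).left :=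
    P.A.restrictPt_left_fst (s' ≫ f) (P.level.σ i)
  rw [h1, h2, h3, Category.assoc, Category.assoc]
  exact congrArg (fun x => s' ≫ x) (h.1.2 i)

/-! ### §2 HEAD: the package moves between two pull-backs over one moduli point -/

/-- **THE (ADM)-PACKAGE MOVES BETWEEN ANY TWO PULL-BACKS OVER ONE MODULI POINT, MARKING EXPOSED.**  `P₁ → Q` along `φ₁`, `P₂ → Q` along `φ₂` pull-backs of
polarized abelian schemes with level-`N` structure (★ `IsBaseChangeVia`), complex points `s₁`, `s₂` with `s₂ ≫ φ₂ = s₁ ≫ φ₁`.  Then an (ADM)-package of `P₁` at `s₁`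
for `(Z, r)` — marking `m₁` of `(P₁)_{s₁}` by `[J(Z), r]`, ample `Θ₁` with `λ̄ = Λ(𝒪(Θ₁))`, symplectic lift `Λ₁` with tower `m₁.r` — yields an (ADM)-package of `P₂` at
`s₂` for the SAME `(Z, r)`, with `γ₂ = γ₁`, `Ψ₂ = Ψ₁` and `toFun₂ = e₂⁻¹(ℂ) ∘ e₁(ℂ) ∘ toFun₁` for the two fibre isomorphisms `eᵢ : (Pᵢ)_{sᵢ} ≅ Q_{s₁ ≫ φ₁}` OVER `Gᵢ`
(returned, so that readings through the markings can be compared in `Q.A`).  Two applications of ★ RD-T1 `exists_admPackage_of_fibreIso` (down to `Q` along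
`e₁`, then up to `P₂` along `e₂`), with §1 for the level sections and ★ `IsBaseChangeVia.transfer_of_fibreIso` ∕ `isLambdaOfAt_of_fibreIso` for the polarisation.
In RD of the E6 closer: `Q := 𝓜.univ`, `P₁ := P_{X_q}` at `φT t` (★ P-3), `P₂ := P` at `x` (`ReadsCReading`).
[cite: MumfordFogartyKirwan1994, Ch. 7 §2 Definition 7.2 (p. 129) and Definition 7.3 (p. 130)] [cite: Milne2005ShimuraVarieties, §6 Thm. 6.11 pp. 74–75]
[cite: Lan2013PELCompactifications, §1.3.6 Lemma 1.3.6.5 (p. 81)] -/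
theorem SiegelAdelicMarking.exists_admPackage_along_isBaseChangeVia₂ {M S₁ S₂ : Scheme.{0}} {Q : PolarizedAbelianSchemeWithLevel g N δ M}
    {P₁ : PolarizedAbelianSchemeWithLevel g N δ S₁} {P₂ : PolarizedAbelianSchemeWithLevel g N δ S₂}
    {φ₁ : S₁ ⟶ M} {G₁ : P₁.A.X.left ⟶ Q.A.X.left} {Ĝ₁ : P₁.D.hat.X.left ⟶ Q.D.hat.X.left} (h₁ : P₁.IsBaseChangeVia Q φ₁ G₁ Ĝ₁)
    {φ₂ : S₂ ⟶ M} {G₂ : P₂.A.X.left ⟶ Q.A.X.left} {Ĝ₂ : P₂.D.hat.X.left ⟶ Q.D.hat.X.left} (h₂ : P₂.IsBaseChangeVia Q φ₂ G₂ Ĝ₂)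
    {s₁ : Spec (.of ℂ) ⟶ S₁} {s₂ : Spec (.of ℂ) ⟶ S₂} (hp : s₂ ≫ φ₂ = s₁ ≫ φ₁)
    (hδ : IsPolarizationType δ) {r : gspFinAdelic δ} {Z : Matrix (Fin g) (Fin g) ℂ} {hZ : Z ∈ siegelUpperHalfSpace g}
    (m₁ : SiegelAdelicMarking ⟨jOfSiegel δ Z, SiegelComplexRecordSystem.jOfSiegel_mem_C0pm hδ.1 hZ⟩ r (P₁.A.fibre s₁).toAbelianVariety)
    (Θ₁ : CartierDivisor (P₁.A.fibre s₁).toAbelianVariety.X.left) (Λ₁ : P₁.level.SymplecticLift s₁ Θ₁ δ)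
    (hample : Θ₁.IsAmple) (hlam : P₁.A.IsLambdaOfAt s₁ P₁.D P₁.pol.lam Θ₁)
    (htower : ∀ ⦃K : ℕ⦄, N ∣ K → K ≠ 0 → ∀ (x : Fin g ⊕ Fin g → ZMod K) (v : Fin g ⊕ Fin g → ℚ),
      AdelicCongr ((r⁻¹ : gspFinAdelic δ) : GL (Fin g ⊕ Fin g) finAdeleQ) 1 v (fun i => ((x i).val : ℚ) / K) →
        ((Λ₁.lift K (Multiplicative.ofAdd x)) : (P₁.A.fibre s₁).toAbelianVariety.Points ℂ) = m₁.r v) :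
    ∃ (e₁ : (P₁.A.fibre s₁).toAbelianVariety ≅ (Q.A.fibre (s₁ ≫ φ₁)).toAbelianVariety)
      (e₂ : (P₂.A.fibre s₂).toAbelianVariety ≅ (Q.A.fibre (s₁ ≫ φ₁)).toAbelianVariety),
      AbelianVariety.Hom.toSchemeHom e₁.hom ≫ pullback.fst Q.A.X.hom (s₁ ≫ φ₁) = pullback.fst P₁.A.X.hom s₁ ≫ G₁ ∧
      AbelianVariety.Hom.toSchemeHom e₂.hom ≫ pullback.fst Q.A.X.hom (s₁ ≫ φ₁) = pullback.fst P₂.A.X.hom s₂ ≫ G₂ ∧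
      ∃ (m₂ : SiegelAdelicMarking ⟨jOfSiegel δ Z, SiegelComplexRecordSystem.jOfSiegel_mem_C0pm hδ.1 hZ⟩ r (P₂.A.fibre s₂).toAbelianVariety)
        (Θ₂ : CartierDivisor (P₂.A.fibre s₂).toAbelianVariety.X.left) (Λ₂ : P₂.level.SymplecticLift s₂ Θ₂ δ),
        Θ₂.IsAmple ∧ P₂.A.IsLambdaOfAt s₂ P₂.D P₂.pol.lam Θ₂ ∧
        (∀ ⦃K : ℕ⦄, N ∣ K → K ≠ 0 → ∀ (x : Fin g ⊕ Fin g → ZMod K) (v : Fin g ⊕ Fin g → ℚ),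
          AdelicCongr ((r⁻¹ : gspFinAdelic δ) : GL (Fin g ⊕ Fin g) finAdeleQ) 1 v (fun i => ((x i).val : ℚ) / K) →
            ((Λ₂.lift K (Multiplicative.ofAdd x)) : (P₂.A.fibre s₂).toAbelianVariety.Points ℂ) = m₂.r v) ∧
        m₂.γ = m₁.γ ∧ m₂.Ψ = m₁.Ψ ∧
        ∀ t : ComplexTorus m₁.Ψ, m₂.toFun t =
          AlgPoints.map e₂.inv.hom.hom.hom (AlgPoints.map e₁.hom.hom.hom.hom (m₁.toFun t)) := by
  -- the two fibre isomorphisms over `G₁`, `G₂` (the second re-typed at the common point by `hp`)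
  obtain ⟨e₁, he₁⟩ := h₁.1.1.exists_fibreIso s₁
  obtain ⟨e₂, he₂⟩ : ∃ e₂ : (P₂.A.fibre s₂).toAbelianVariety ≅ (Q.A.fibre (s₁ ≫ φ₁)).toAbelianVariety,
      AbelianVariety.Hom.toSchemeHom e₂.hom ≫ pullback.fst Q.A.X.hom (s₁ ≫ φ₁) = pullback.fst P₂.A.X.hom s₂ ≫ G₂ := by
    rw [← hp]
    exact h₂.1.1.exists_fibreIso s₂
  refine ⟨e₁, e₂, he₁, he₂, ?_⟩
  -- STEP A: down to `Q` at `s₁ ≫ φ₁` along `e₁⁻¹`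
  have heA : ∀ i : Fin g ⊕ Fin g, AlgPoints.map e₁.symm.hom.hom.hom.hom (Q.A.restrictPt (s₁ ≫ φ₁) (Q.level.σ i)) =
      P₁.A.restrictPt s₁ (P₁.level.σ i) := by
    intro i
    rw [← map_restrictPt_level_eq_of_fibreIso h₁ s₁ e₁ he₁ i, ← AlgPoints.map_comp_apply]
    change AlgPoints.map (e₁.hom ≫ e₁.inv).hom.hom.hom _ = _
    rw [e₁.hom_inv_id]
    exact AlgPoints.map_id_apply _
  have hpolA : ∀ Θ : CartierDivisor (P₁.A.fibre s₁).toAbelianVariety.X.left, Θ.IsAmple → P₁.A.IsLambdaOfAt s₁ P₁.D P₁.pol.lam Θ →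
      haveI := AbelianVariety.isDominant_toSchemeHom_iso_hom e₁.symm
      (Θ.pullback (AbelianVariety.Hom.toSchemeHom e₁.symm.hom)).IsAmple ∧
        Q.A.IsLambdaOfAt (s₁ ≫ φ₁) Q.D Q.pol.lam (Θ.pullback (AbelianVariety.Hom.toSchemeHom e₁.symm.hom)) :=
    fun Θ hΘ hl => PolarizedAbelianSchemeWithLevel.IsBaseChangeVia.transfer_of_fibreIso s₁ e₁ he₁ h₁ Θ hΘ hl
  obtain ⟨mQ, ΘQ, ΛQ, hampleQ, hlamQ, htowerQ, hγQ, hΨQ, htoFunQ⟩ :=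
    SiegelAdelicMarking.exists_admPackage_of_fibreIso hδ (hZ := hZ) e₁.symm heA hpolA m₁ Θ₁ Λ₁ hample hlam htower
  -- STEP B: up to `P₂` at `s₂` along `e₂` (the ★ transports, re-typed at the common point by `hp`)
  have keyB : ∀ (e : (P₂.A.fibre s₂).toAbelianVariety ≅ (Q.A.fibre (s₁ ≫ φ₁)).toAbelianVariety),
      AbelianVariety.Hom.toSchemeHom e.hom ≫ pullback.fst Q.A.X.hom (s₁ ≫ φ₁) = pullback.fst P₂.A.X.hom s₂ ≫ G₂ →
      (∀ i : Fin g ⊕ Fin g, AlgPoints.map e.hom.hom.hom.hom (P₂.A.restrictPt s₂ (P₂.level.σ i)) = Q.A.restrictPt (s₁ ≫ φ₁) (Q.level.σ i)) ∧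
      ∀ Θ : CartierDivisor (Q.A.fibre (s₁ ≫ φ₁)).toAbelianVariety.X.left, Θ.IsAmple → Q.A.IsLambdaOfAt (s₁ ≫ φ₁) Q.D Q.pol.lam Θ →
        haveI := AbelianVariety.isDominant_toSchemeHom_iso_hom e
        (Θ.pullback (AbelianVariety.Hom.toSchemeHom e.hom)).IsAmple ∧
          P₂.A.IsLambdaOfAt s₂ P₂.D P₂.pol.lam (Θ.pullback (AbelianVariety.Hom.toSchemeHom e.hom)) := by
    rw [← hp]
    intro e he
    refine ⟨fun i => map_restrictPt_level_eq_of_fibreIso h₂ s₂ e he i, fun Θ hΘ hl => ⟨?_, ?_⟩⟩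
    · haveI := Literature.AlgebraicGeometry.AbelianSchemes.AbelianSchemeOver.isIso_toSchemeHom_of_iso e
      exact hΘ.pullback _
    · exact PolarizedAbelianSchemeWithLevel.IsBaseChangeVia.isLambdaOfAt_of_fibreIso s₂ e he h₂ Θ hl
  obtain ⟨heB, hpolB⟩ := keyB e₂ he₂
  obtain ⟨m₂, Θ₂, Λ₂, hample₂, hlam₂, htower₂, hγ₂, hΨ₂, htoFun₂⟩ :=
    SiegelAdelicMarking.exists_admPackage_of_fibreIso hδ (hZ := hZ) e₂ heB hpolB mQ ΘQ ΛQ hampleQ hlamQ htowerQ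
  refine ⟨m₂, Θ₂, Λ₂, hample₂, hlam₂, htower₂, hγ₂.trans hγQ, hΨ₂.trans hΨQ, ?_⟩
  intro t
  have h1 : m₂.toFun t = AlgPoints.map e₂.inv.hom.hom.hom (mQ.toFun t) := htoFun₂ t
  have h2 : mQ.toFun t = AlgPoints.map e₁.hom.hom.hom.hom (m₁.toFun t) := htoFunQ t
  rw [h2] at h1
  exact h1

end Literature.AlgebraicGeometry.ModuliOfAbelianVarieties

end
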